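import Summits.AtomisticToContinuum.HydrodynamicLimit.Theorems.JParityClosureParityBandClosureWindowCovarianceIsotropyG
import HarnessLib

/-!
# Window covariance isotropy (crux `JParityClosure.ParityBandClosure`, stmt-AtomisticToContinuum-17608, line
# `transfer-weighted-parity-chain`, stub `stub_windowCovarianceIsotropy`) — helper H: integration OVER the windows

WHAT.  §1 The tent integrates to at most `2` over any time window (`setIntegral_btent_le_two`).  §2 INTEGRATION OVER THE
WINDOWS `(t₀, x₀) ∈ [0, τ] × 𝕋³` (Fubini for bounded jointly measurable integrands, `∫ cone ≤ 4`, `∫ btent ≤ 2`): a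
law-type functional with a nonnegative test integrates to at most `8 ∫₀^τ (N+1)⁻¹ Σₖ ψ(vₖ(s)) ds`
(`integral_integral_lawFun_le`), a record-type functional with nonnegative marks to at most `8 Σ_{contacts} m`
(`integral_integral_recFun_le`) — the two inequalities that turn per-window (Chebyshev) budgets into global ones
(time-integrated velocity moments; the normalised collision functional of `CollisionTightness`).

REFERENCES.  Elementary measure theory (Mathlib `integral_integral_swap`); H. Spohn (1991), Part I §3.  No named fact.
-/

noncomputable section

namespace Summit.AtomisticToContinuum.HydrodynamicLimit.Theorems.ParityBandClosureWindowCovariance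

open scoped BigOperators Topology Classical MeasureTheory ENNReal InnerProductSpace
open Filter Set MeasureTheory Function Topology
open Literature.MathematicalPhysics.KineticTheory
open Literature.Analysis.FluidPDE
open Summit.AtomisticToContinuum.HydrodynamicLimit.Theorems.LocalSecondLawNegative (cone cone_nonneg cone_le
  continuous_cone integral_cone_le)

variable {N : ℕ}

/-! ## §1 The tent integrates to at most `2` over every time window -/

/-- `∫_{[a,b]} btent(s − t₀) dt₀ ≤ 2` (height `r⁻²` on an interval of length `2r²`). [folklore] -/
theorem setIntegral_btent_le_two {r : ℝ} (hr : 0 < r) (s a b : ℝ) :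
    ∫ t₀ in Set.Icc a b, btent r (s - t₀) ≤ 2 := by
  have hr2 : 0 < r ^ 2 := by positivity
  have hpt : ∀ t₀, btent r (s - t₀) ≤ (r ^ 2)⁻¹ * (Set.Icc (s - r ^ 2) (s + r ^ 2)).indicator (fun _ => (1 : ℝ)) t₀ := by
    intro t₀
    by_cases ht : t₀ ∈ Set.Icc (s - r ^ 2) (s + r ^ 2)
    · rw [Set.indicator_of_mem ht, mul_one]; exact btent_le _ _
    · rw [Set.indicator_of_notMem ht, mul_zero]
      refine le_of_eq (btent_eq_zero hr ?_)
      rw [Set.mem_Icc, not_and_or, not_le, not_le] at ht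
      rcases ht with h | h
      · rw [abs_of_pos (by linarith)]; linarith
      · rw [abs_of_neg (by linarith)]; linarith
  have hcont : Continuous fun t₀ => btent r (s - t₀) := (continuous_btent r).comp (continuous_const.sub continuous_id)
  have hind0 : Integrable (fun t₀ => (Set.Icc (s - r ^ 2) (s + r ^ 2)).indicator (fun _ => (1 : ℝ)) t₀) :=
    (integrable_indicator_iff measurableSet_Icc).2 (continuous_const.integrableOn_Icc)
  have hind : Integrable (fun t₀ => (r ^ 2)⁻¹ * (Set.Icc (s - r ^ 2) (s + r ^ 2)).indicator (fun _ => (1 : ℝ)) t₀) :=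
    hind0.const_mul _
  calc ∫ t₀ in Set.Icc a b, btent r (s - t₀)
      ≤ ∫ t₀ in Set.Icc a b, (r ^ 2)⁻¹ * (Set.Icc (s - r ^ 2) (s + r ^ 2)).indicator (fun _ => (1 : ℝ)) t₀ :=
        integral_mono (hcont.integrableOn_Icc) hind.integrableOn fun t₀ => hpt t₀
    _ ≤ ∫ t₀, (r ^ 2)⁻¹ * (Set.Icc (s - r ^ 2) (s + r ^ 2)).indicator (fun _ => (1 : ℝ)) t₀ :=
        setIntegral_le_integral hind (Eventually.of_forall fun t₀ => by
          exact mul_nonneg (by positivity) (Set.indicator_nonneg (fun _ _ => zero_le_one) _))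
    _ = 2 := by
        rw [integral_const_mul, integral_indicator_const (1 : ℝ) measurableSet_Icc, smul_eq_mul, mul_one,
          measureReal_def, Real.volume_Icc, ENNReal.toReal_ofReal (by linarith)]
        field_simp
        ring

/-! ## §2 Integration over the windows -/

section Over

variable {ε r τ : ℝ} {γ : ℝ → Config (N + 1) (Fin 3) T3}

/-- `∫ cone(y, ·) ≤ 4` pulled through the cone-weighted mean of nonnegative marks:
`∫ (N+1)⁻¹ Σₖ cone(xₖ, x₀) ψₖ dx₀ ≤ 4 (N+1)⁻¹ Σₖ ψₖ`. [folklore] -/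
theorem integral_mean_cone_mul_le (hr : 0 < r) (hr2 : r < 1 / 2) (w : Config (N + 1) (Fin 3) T3) {ψ : V3 → ℝ}
    (hψ : ∀ v, 0 ≤ ψ v) :
    ∫ x₀ : T3, ((N + 1 : ℕ) : ℝ)⁻¹ * ∑ k, cone r (w k).1 x₀ * ψ (w k).2 ≤ 4 * (((N + 1 : ℕ) : ℝ)⁻¹ * ∑ k, ψ (w k).2) := by
  have hint : ∀ k : Fin (N + 1), Integrable (fun x₀ : T3 => cone r (w k).1 x₀ * ψ (w k).2) := fun k =>
    (integrable_of_continuous_T3 (continuous_cone r (w k).1)).mul_const _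
  rw [integral_const_mul, integral_finsetSum _ fun k _ => hint k, Finset.mul_sum, Finset.mul_sum, Finset.mul_sum]
  refine Finset.sum_le_sum fun k _ => ?_
  rw [integral_mul_const]
  calc ((N + 1 : ℕ) : ℝ)⁻¹ * ((∫ x₀ : T3, cone r (w k).1 x₀) * ψ (w k).2)
      ≤ ((N + 1 : ℕ) : ℝ)⁻¹ * (4 * ψ (w k).2) :=
        mul_le_mul_of_nonneg_left (mul_le_mul_of_nonneg_right (integral_cone_le hr hr2 _) (hψ _)) (by positivity)
    _ = _ := by ring

/-- **Integration of a law-type window functional over the windows**: for a nonnegative measurable test `ψ`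
bounded along the path,
`∫_{t₀ ∈ [0,τ]} ∫_{x₀} (∫ btent ∫ cone ψ dμ ds) ≤ 8 ∫_{s ∈ [0,τ]} (N+1)⁻¹ Σₖ ψ(vₖ(s)) ds`. [folklore] -/
theorem integral_integral_lawFun_le (hγ : Measurable γ) (hr : 0 < r) (hr2 : r < 1 / 2)
    {ψ : V3 → ℝ} (hψm : Measurable ψ) (hψ0 : ∀ v, 0 ≤ ψ v) {C : ℝ} (hC : ∀ s k, ψ (γ s k).2 ≤ C) :
    ∫ t₀ in Set.Icc (0 : ℝ) τ, ∫ x₀ : T3, (∫ s in Set.Icc (0 : ℝ) τ, btent r (s - t₀) *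
        ∫ q, cone r q.1 x₀ * ψ q.2 ∂(empiricalMeasure (γ s))) ≤
      8 * ∫ s in Set.Icc (0 : ℝ) τ, ((N + 1 : ℕ) : ℝ)⁻¹ * ∑ k, ψ (γ s k).2 := by
  have hvk : ∀ k : Fin (N + 1), Measurable fun s : ℝ => (γ s k).2 := fun k => ((measurable_pi_apply k).comp hγ).snd
  have hxk : ∀ k : Fin (N + 1), Measurable fun s : ℝ => (γ s k).1 := fun k => ((measurable_pi_apply k).comp hγ).fst
  have hC0 : 0 ≤ C := (hψ0 _).trans (hC 0 0)
  haveI : IsFiniteMeasure (volume.restrict (Set.Icc (0 : ℝ) τ)) := ⟨by rw [Measure.restrict_apply_univ, Real.volume_Icc]; exact ENNReal.ofReal_lt_top⟩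
  -- the cone-weighted mean and the plain mean
  obtain ⟨A, hA⟩ : ∃ A : ℝ → T3 → ℝ, A = fun s x₀ => ((N + 1 : ℕ) : ℝ)⁻¹ * ∑ k, cone r (γ s k).1 x₀ * ψ (γ s k).2 :=
    ⟨_, rfl⟩
  obtain ⟨Φ, hΦ⟩ : ∃ Φ : ℝ → ℝ, Φ = fun s => ((N + 1 : ℕ) : ℝ)⁻¹ * ∑ k, ψ (γ s k).2 := ⟨_, rfl⟩
  have hAm : Measurable fun q : ℝ × T3 => A q.1 q.2 := by
    rw [hA]
    refine measurable_const.mul (Finset.measurable_sum _ fun k _ => ?_)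
    exact (measurable_cone_comp r ((hxk k).comp measurable_fst) measurable_snd).mul (hψm.comp ((hvk k).comp measurable_fst))
  have hA0 : ∀ s x₀, 0 ≤ A s x₀ := fun s x₀ => by
    rw [hA]
    exact mul_nonneg (by positivity) (Finset.sum_nonneg fun k _ => mul_nonneg (cone_nonneg hr _ _) (hψ0 _))
  have hAb : ∀ s x₀, |A s x₀| ≤ 3 / (Real.pi * r ^ 3) * C := fun s x₀ => by
    rw [hA]
    exact abs_mean_cone_mul_le' hr x₀ (γ s) fun k => by rw [abs_of_nonneg (hψ0 _)]; exact hC s k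
  have hΦm : Measurable Φ := by
    rw [hΦ]; exact measurable_const.mul (Finset.measurable_sum _ fun k _ => hψm.comp (hvk k))
  have hΦ0 : ∀ s, 0 ≤ Φ s := fun s => by
    rw [hΦ]; exact mul_nonneg (by positivity) (Finset.sum_nonneg fun k _ => hψ0 _)
  have hΦb : ∀ s, |Φ s| ≤ C := fun s => by
    rw [abs_of_nonneg (hΦ0 s), hΦ]
    calc ((N + 1 : ℕ) : ℝ)⁻¹ * ∑ k, ψ (γ s k).2 ≤ ((N + 1 : ℕ) : ℝ)⁻¹ * ∑ _k : Fin (N + 1), C :=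
          mul_le_mul_of_nonneg_left (Finset.sum_le_sum fun k _ => hC s k) (by positivity)
      _ = C := by
          rw [Finset.sum_const, Finset.card_univ, Fintype.card_fin, nsmul_eq_mul, ← mul_assoc,
            inv_mul_cancel₀ (by positivity), one_mul]
  have hIA : ∀ s, ∫ x₀, A s x₀ ≤ 4 * Φ s := fun s => by
    have h := integral_mean_cone_mul_le hr hr2 (γ s) hψ0
    rw [hA, hΦ]
    exact h
  -- rewrite the functional through `A`
  have hfun : ∀ t₀ x₀, (∫ s in Set.Icc (0 : ℝ) τ, btent r (s - t₀) * ∫ q, cone r q.1 x₀ * ψ q.2 ∂(empiricalMeasure (γ s))) =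
      ∫ s in Set.Icc (0 : ℝ) τ, btent r (s - t₀) * A s x₀ := by
    intro t₀ x₀
    refine integral_congr_ae (Eventually.of_forall fun s => ?_)
    show btent r (s - t₀) * ∫ q, cone r q.1 x₀ * ψ q.2 ∂(empiricalMeasure (γ s)) = btent r (s - t₀) * A s x₀
    rw [integral_empiricalMeasure, hA]
  -- ### step 1–2: the inner window integral, swapped and bounded
  have hstep : ∀ t₀, ∫ x₀ : T3, (∫ s in Set.Icc (0 : ℝ) τ, btent r (s - t₀) * A s x₀) ≤
      ∫ s in Set.Icc (0 : ℝ) τ, btent r (s - t₀) * (4 * Φ s) := by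
    intro t₀
    have hbt : Measurable fun s : ℝ => btent r (s - t₀) := (continuous_btent r).measurable.comp (measurable_id.sub_const t₀)
    have hI : Integrable (uncurry fun (x₀ : T3) (s : ℝ) => btent r (s - t₀) * A s x₀)
        ((volume : Measure T3).prod (volume.restrict (Set.Icc (0 : ℝ) τ))) := by
      have hm1 : Measurable fun q : T3 × ℝ => btent r (q.2 - t₀) := hbt.comp measurable_snd
      have hm2 : Measurable fun q : T3 × ℝ => A q.2 q.1 := hAm.comp (measurable_snd.prodMk measurable_fst)
      have hm : Measurable fun q : T3 × ℝ => btent r (q.2 - t₀) * A q.2 q.1 := hm1.mul hm2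
      refine Integrable.mono' (integrable_const ((r ^ 2)⁻¹ * (3 / (Real.pi * r ^ 3) * C))) hm.aestronglyMeasurable
        (Eventually.of_forall fun q => ?_)
      rw [Real.norm_eq_abs]
      show |btent r (q.2 - t₀) * A q.2 q.1| ≤ _
      rw [abs_mul, abs_of_nonneg (btent_nonneg _ _)]
      exact mul_le_mul (btent_le _ _) (hAb _ _) (abs_nonneg _) (by positivity)
    rw [integral_integral_swap hI]
    have hi1 : Integrable (fun s => ∫ x₀ : T3, btent r (s - t₀) * A s x₀) (volume.restrict (Set.Icc (0 : ℝ) τ)) :=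
      hI.swap.integral_prod_left
    have hi2 : Integrable (fun s => btent r (s - t₀) * (4 * Φ s)) (volume.restrict (Set.Icc (0 : ℝ) τ)) := by
      refine Integrable.mono' (integrable_const ((r ^ 2)⁻¹ * (4 * C))) ((hbt.mul (hΦm.const_mul _)).aestronglyMeasurable)
        (Eventually.of_forall fun s => ?_)
      rw [Real.norm_eq_abs, abs_mul, abs_of_nonneg (btent_nonneg _ _), abs_mul, abs_of_pos (by norm_num : (0 : ℝ) < 4)]
      exact mul_le_mul (btent_le _ _) (mul_le_mul_of_nonneg_left (hΦb s) (by norm_num)) (by positivity) (by positivity)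
    refine integral_mono hi1 hi2 fun s => ?_
    show ∫ x₀ : T3, btent r (s - t₀) * A s x₀ ≤ btent r (s - t₀) * (4 * Φ s)
    rw [integral_const_mul]
    exact mul_le_mul_of_nonneg_left (hIA s) (btent_nonneg _ _)
  -- ### step 3–4: the outer time integral, swapped and bounded
  have hJ : Integrable (uncurry fun (t₀ : ℝ) (s : ℝ) => btent r (s - t₀) * (4 * Φ s))
      ((volume.restrict (Set.Icc (0 : ℝ) τ)).prod (volume.restrict (Set.Icc (0 : ℝ) τ))) := by
    have hm1 : Measurable fun q : ℝ × ℝ => btent r (q.2 - q.1) :=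
      (continuous_btent r).measurable.comp (measurable_snd.sub measurable_fst)
    have hm2 : Measurable fun q : ℝ × ℝ => 4 * Φ q.2 := (hΦm.comp measurable_snd).const_mul _
    have hm : Measurable fun q : ℝ × ℝ => btent r (q.2 - q.1) * (4 * Φ q.2) := hm1.mul hm2
    refine Integrable.mono' (integrable_const ((r ^ 2)⁻¹ * (4 * C))) hm.aestronglyMeasurable
      (Eventually.of_forall fun q => ?_)
    rw [Real.norm_eq_abs]
    show |btent r (q.2 - q.1) * (4 * Φ q.2)| ≤ _
    rw [abs_mul, abs_of_nonneg (btent_nonneg _ _), abs_mul, abs_of_pos (by norm_num : (0 : ℝ) < 4)]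
    exact mul_le_mul (btent_le _ _) (mul_le_mul_of_nonneg_left (hΦb _) (by norm_num)) (by positivity) (by positivity)
  calc ∫ t₀ in Set.Icc (0 : ℝ) τ, ∫ x₀ : T3, (∫ s in Set.Icc (0 : ℝ) τ, btent r (s - t₀) *
          ∫ q, cone r q.1 x₀ * ψ q.2 ∂(empiricalMeasure (γ s)))
      = ∫ t₀ in Set.Icc (0 : ℝ) τ, ∫ x₀ : T3, (∫ s in Set.Icc (0 : ℝ) τ, btent r (s - t₀) * A s x₀) := by
        simp_rw [hfun]
    _ ≤ ∫ t₀ in Set.Icc (0 : ℝ) τ, ∫ s in Set.Icc (0 : ℝ) τ, btent r (s - t₀) * (4 * Φ s) := by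
        refine integral_mono_of_nonneg (Eventually.of_forall fun t₀ => integral_nonneg fun x₀ =>
          integral_nonneg fun s => mul_nonneg (btent_nonneg _ _) (hA0 _ _)) hJ.integral_prod_left
          (Eventually.of_forall fun t₀ => hstep t₀)
    _ = ∫ s in Set.Icc (0 : ℝ) τ, ∫ t₀ in Set.Icc (0 : ℝ) τ, btent r (s - t₀) * (4 * Φ s) := integral_integral_swap hJ
    _ ≤ ∫ s in Set.Icc (0 : ℝ) τ, 2 * (4 * Φ s) := by
        have hi3 : Integrable (fun s => 2 * (4 * Φ s)) (volume.restrict (Set.Icc (0 : ℝ) τ)) := by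
          refine Integrable.mono' (integrable_const (2 * (4 * C))) (((hΦm.const_mul _).const_mul _).aestronglyMeasurable)
            (Eventually.of_forall fun s => ?_)
          rw [Real.norm_eq_abs, abs_mul, abs_mul, abs_of_pos (by norm_num : (0 : ℝ) < 2),
            abs_of_pos (by norm_num : (0 : ℝ) < 4)]
          exact mul_le_mul_of_nonneg_left (mul_le_mul_of_nonneg_left (hΦb s) (by norm_num)) (by norm_num)
        refine integral_mono hJ.swap.integral_prod_left hi3 fun s => ?_
        show ∫ t₀ in Set.Icc (0 : ℝ) τ, btent r (s - t₀) * (4 * Φ s) ≤ 2 * (4 * Φ s)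
        rw [integral_mul_const]
        exact mul_le_mul_of_nonneg_right (setIntegral_btent_le_two hr s 0 τ) (mul_nonneg (by norm_num) (hΦ0 s))
    _ = 8 * ∫ s in Set.Icc (0 : ℝ) τ, ((N + 1 : ℕ) : ℝ)⁻¹ * ∑ k, ψ (γ s k).2 := by
        rw [← integral_const_mul]
        refine integral_congr_ae (Eventually.of_forall fun s => ?_)
        show 2 * (4 * Φ s) = 8 * (((N + 1 : ℕ) : ℝ)⁻¹ * ∑ k, ψ (γ s k).2)
        rw [hΦ]
        ring

/-- **Integration of a record-type window functional over the windows**: for nonnegative marks,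
`∫_{t₀ ∈ [0,τ]} ∫_{x₀} Σ_{contacts} btent(s − t₀) cone(xᵢ, x₀) m ≤ 8 Σ_{contacts} m`. [folklore] -/
theorem integral_integral_recFun_le (hfin : (collisionTimes (Torus.geometry (Fin 3)) ε γ ∩ Set.Icc 0 τ).Finite)
    (hr : 0 < r) (hr2 : r < 1 / 2) {m : ℝ → Fin (N + 1) → Fin (N + 1) → ℝ} (hm : ∀ s i j, 0 ≤ m s i j) :
    ∫ t₀ in Set.Icc (0 : ℝ) τ, ∫ x₀ : T3, collisionPairSum (Torus.geometry (Fin 3)) ε γ (Set.Icc 0 τ)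
        (fun s i j => btent r (s - t₀) * cone r (γ s i).1 x₀ * m s i j) ≤
      8 * collisionPairSum (Torus.geometry (Fin 3)) ε γ (Set.Icc 0 τ) m := by
  set F := hfin.toFinset with hF
  -- the inner space integral, in closed form and bounded
  have hx : ∀ t₀, ∫ x₀ : T3, collisionPairSum (Torus.geometry (Fin 3)) ε γ (Set.Icc 0 τ)
      (fun s i j => btent r (s - t₀) * cone r (γ s i).1 x₀ * m s i j) ≤
      ∑ t ∈ F, ∑ q ∈ contactPairs (Torus.geometry (Fin 3)) ε (γ t), btent r (t - t₀) * m t q.1 q.2 * 4 := by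
    intro t₀
    have hint : ∀ t (q : Fin (N + 1) × Fin (N + 1)),
        Integrable (fun x₀ : T3 => btent r (t - t₀) * cone r (γ t q.1).1 x₀ * m t q.1 q.2) := fun t q =>
      ((integrable_of_continuous_T3 (continuous_cone r (γ t q.1).1)).const_mul _).mul_const _
    simp_rw [collisionPairSum_eq_finset_sum hfin]
    rw [integral_finsetSum _ fun t _ => integrable_finsetSum _ fun q _ => hint t q]
    refine Finset.sum_le_sum fun t _ => ?_
    rw [integral_finsetSum _ fun q _ => hint t q]
    refine Finset.sum_le_sum fun q _ => ?_
    have e : (fun x₀ : T3 => btent r (t - t₀) * cone r (γ t q.1).1 x₀ * m t q.1 q.2) =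
        fun x₀ => (btent r (t - t₀) * m t q.1 q.2) * cone r (γ t q.1).1 x₀ := by funext x₀; ring
    rw [e, integral_const_mul]
    exact mul_le_mul_of_nonneg_left (integral_cone_le hr hr2 _) (mul_nonneg (btent_nonneg _ _) (hm _ _ _))
  -- the outer time integral
  have hcont : ∀ t, Continuous fun t₀ : ℝ => btent r (t - t₀) := fun t =>
    (continuous_btent r).comp (continuous_const.sub continuous_id)
  have hint2 : ∀ t (q : Fin (N + 1) × Fin (N + 1)),
      IntegrableOn (fun t₀ : ℝ => btent r (t - t₀) * m t q.1 q.2 * 4) (Set.Icc (0 : ℝ) τ) volume := fun t q =>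
    (((hcont t).mul continuous_const).mul continuous_const).integrableOn_Icc
  have hup : IntegrableOn (fun t₀ : ℝ => ∑ t ∈ F, ∑ q ∈ contactPairs (Torus.geometry (Fin 3)) ε (γ t),
      btent r (t - t₀) * m t q.1 q.2 * 4) (Set.Icc (0 : ℝ) τ) volume :=
    integrable_finsetSum _ fun t _ => integrable_finsetSum _ fun q _ => hint2 t q
  calc ∫ t₀ in Set.Icc (0 : ℝ) τ, ∫ x₀ : T3, collisionPairSum (Torus.geometry (Fin 3)) ε γ (Set.Icc 0 τ)
          (fun s i j => btent r (s - t₀) * cone r (γ s i).1 x₀ * m s i j)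
      ≤ ∫ t₀ in Set.Icc (0 : ℝ) τ, ∑ t ∈ F, ∑ q ∈ contactPairs (Torus.geometry (Fin 3)) ε (γ t),
          btent r (t - t₀) * m t q.1 q.2 * 4 := by
        refine integral_mono_of_nonneg (Eventually.of_forall fun t₀ => integral_nonneg fun x₀ =>
          collisionPairSum_nonneg fun s i j => mul_nonneg (mul_nonneg (btent_nonneg _ _) (cone_nonneg hr _ _))
            (hm _ _ _)) hup (Eventually.of_forall fun t₀ => hx t₀)
    _ = ∑ t ∈ F, ∑ q ∈ contactPairs (Torus.geometry (Fin 3)) ε (γ t),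
          ∫ t₀ in Set.Icc (0 : ℝ) τ, btent r (t - t₀) * m t q.1 q.2 * 4 := by
        rw [integral_finsetSum _ fun t _ => integrable_finsetSum _ fun q _ => hint2 t q]
        refine Finset.sum_congr rfl fun t _ => ?_
        rw [integral_finsetSum _ fun q _ => hint2 t q]
    _ ≤ ∑ t ∈ F, ∑ q ∈ contactPairs (Torus.geometry (Fin 3)) ε (γ t), 8 * m t q.1 q.2 := by
        refine Finset.sum_le_sum fun t _ => Finset.sum_le_sum fun q _ => ?_
        rw [integral_mul_const, integral_mul_const]
        have h2 := setIntegral_btent_le_two hr t 0 τ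
        have hm0 := hm t q.1 q.2
        nlinarith
    _ = 8 * collisionPairSum (Torus.geometry (Fin 3)) ε γ (Set.Icc 0 τ) m := by
        rw [collisionPairSum_eq_finset_sum hfin, Finset.mul_sum]
        refine Finset.sum_congr rfl fun t _ => ?_
        rw [Finset.mul_sum]

end Over

/-- **Registered sub-goal `stub_wciTentWindowMass` (helper H of `stub_windowCovarianceIsotropy`): over every time
window the tent `(r²)⁻¹(1 − |s − t₀|/r²)₊` integrates in `t₀` to at most `2`** (the time half of "a bad window set
of small measure carries little of anything"). [folklore] -/
theorem stub_wciTentWindowMass : ∀ {r : ℝ}, 0 < r → ∀ s a b : ℝ, ∫ t₀ in Set.Icc a b, (r ^ 2)⁻¹ * max (1 - |s - t₀| / r ^ 2) 0 ≤ 2 :=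
  fun hr s a b => setIntegral_btent_le_two hr s a b

end Summit.AtomisticToContinuum.HydrodynamicLimit.Theorems.ParityBandClosureWindowCovariance

end
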